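import Summits.QuantumFields.YangMills.Theorems.UnitScaleTiltProp7AvgHessGaugeT2Letters
import HarnessLib

/-!
# (q-gauge) SUPPLIER — **THE NORM READING OF S1-SPEC (2)**: ✓p772811's letter `hId` (concrete currency) FROM THE POINTWISE SECOND-ORDER GAUGE-COVARIANCE IDENTITY (2), and the
# letter `hκY` FROM «FR₂-lite» IN SITE-MASS FORM — so that the supplier of ✓p768852's gauge-spike row `hqG` is typed modulo LITERALLY ⟨(2) pointwise, FR₂-lite (site mass)⟩

Cell `ym3-torus` (HUMAN RULING D-0037, YM ladder rung R3 — SU(2) YM₃ on T³: NOT d = 4, NOT infinite volume, NOT a mass gap, NOT Clay).  Width seat `ym3-torus-px19` (gen 14);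
chair ★`ym-ust-19200-p1` g27 WORD №29 (2) «(q-gauge) → px19 g14».  THEOREMS ONLY (0 `def`, 0 `sorry`, default heartbeats); `--supports stmt-QuantumFields-19200 --as helper`; count-neutral.

THE PRINT.  [Balaban1985BackgroundPropagators] (3.13) p.392, (3.14)–(3.16) and (3.19) p.393, (3.114)–(3.115) p.418 (gauge covariance of the averaging); [Balaban1985Averaging] (11) p.19,
(97) p.32, Prop. 5 (157) p.42.

THE MATHEMATICS (S1-SPEC (2), 19200 evidence #54).  Write `S = logChartTwS U₀`, `σ_c := QTwS U₀ Y (c)` (`= ∂_Y` of `D_A(c) = dbarTwS A c` at `A = 0`, since `D_0 = 1`, `D mlog(1) = id`),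
`E(ĉ) := Ū₀♭⁽ᵏ⁾(ĉ)`, `ns` the averaging sequence of `N = δ_x ⊗ A` ((97); `𝓚₀N = ns_(K−n)` by ✓`hasDerivAt_frameAccU_of_avgSeq`), `P_c := ns(ĉ₋) + E(ĉ)ns(ĉ₊)E(ĉ)⁻¹`, `κY := ∂_Y 𝓚_A N|₀`
(the chart derivative of the frame-corrected coarse parameter — the «FR₂-lite» object).  Differentiating the first-order law ✓`Prop7ChartGaugeCovarianceDeriv.fderiv_logChartTwS_gaugeVelocity_apply`
along the chart point `A = sY` at `s = 0` — the chart pull-back of the gauge velocity being `V_A = (N − Ad N′) + [½(N + Ad N′), A] + O(A²)` (the conjugation part of `e^(tN)·e^A·e^(−t·AdN′)` acts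
linearly on the logarithm; the symmetric part has no first-order commutator by the symmetric BCH formula) and `D²mlog(1)[σ, R] = −½(σR + Rσ)` — gives THE POINTWISE IDENTITY (2):
`avgHess U₀ Y (gd N)(c) = −½·QTwS U₀ ([N + AdN′, Y])(c) + ½·[P_c, σ_c] + (κY(ĉ₋) − E(ĉ)κY(ĉ₊)E(ĉ)⁻¹)` (abelian check: both commutators vanish and the Hessian in a gauge direction is
the coarse gradient of the mixed derivative of the coarse gauge parameter, as it must).  READ IN NORM with `E(ĉ) ∈ U1` (✓`emlIterU_bgUnits_mem_U1_of_regPr`), `‖σ_c‖ ≤ ‖QTwS U₀ Y‖_∞`,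
`‖½[P, σ]‖ ≤ ‖P‖‖σ‖`, and summed over the coarse bonds, (2) gives ✓p772811's `hId` VERBATIM with `MK Y x A := Σ_c (‖κY(ĉ₋)‖ + ‖κY(ĉ₊)‖) = 6·Σ_z ‖κY z‖` — whence «FR₂-lite» is wanted exactly
in SITE-MASS form `Σ_z ‖κY z‖ ≤ C·ℓ⁻²·s·‖A‖` (`C₃ = 6C`).

WHAT IS PROVED (member `F`, `h : n ≤ K`, `U₀ ∈ 𝔘_k(ε₀)`).
* §1 letters: `norm_half_comm_le` (`‖2⁻¹•(Pσ − σP)‖ ≤ ‖P‖·‖σ‖`), `norm_conj_le_of_mem_U1` ∕ `norm_add_conj_le_of_mem_U1` ∕ `norm_sub_conj_le_of_mem_U1` (`‖a ± E b E⁻¹‖ ≤ ‖a‖ + ‖b‖` for `E ∈ U1`),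
  ★ `sum_norm_bondShift_ends_eq` (`Σ_(c : PBond (F.P n) 0) (‖f ĉ.src‖ + ‖f ĉ.tgt‖) = 6·Σ_z ‖f z‖` on the comparison lattice).
* §2 ★★★ `hId_of_pointwise_identity` — `RegPr F n K ε₀ U₀`, `10¹²L³ε₀ ≤ 1`, and (2) POINTWISE for the spike family (`h2`, with the families `ns`, `κY`) ⟹ ✓p772811 §3's letter `hId` VERBATIM
  (`MK Y x A := Σ_c (‖κY Y x A ĉ.src‖ + ‖κY Y x A ĉ.tgt‖)`).
* §3 ★★★ `gaugeDir_column_of_pointwise_identity_and_FR2` ∕ ★★★ `hqG_member_of_pointwise_identity_and_FR2` — from `h2` + «FR₂-lite» in site-mass form `hFR2 : Σ_z ‖κY Y x A z‖ ≤ C·ℓ⁻²·s·‖A‖`: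
  the core column `≤ (240 + 6C)·ℓ⁻²·s·‖A‖` and ✓p768852's member row with `qG := η⁻¹·(240 + 6C)·ℓ⁻²` (✓p772811 §3 with `C₃ := 6C`).
* §4 ★★★ `hqG_of_pointwise_identity_and_FR2_family` — ✓p768852's DISPLAYED family hypothesis `hqG` VERBATIM with `qG L := 240 + 6·C L`, from the per-member ⟨(2), FR₂-lite⟩.
HYP-SAT (★★OWNER RULING №42): `h2` is the pointwise identity (2) — OPEN (the `Y`-derivative of ✓p769222 at `A = 0`; every ingredient named above exists in the tree except the second
derivative of the accumulated frames along (chart × gauge), which DEFINES `κY`), displayed honestly: an IDENTITY between the file's objects and the two abstract families `ns` (pinned by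
`h0`∕`hsucc` in §3) and `κY` (pinned by (2) itself and `hFR2` — the supplier produces `κY := ∂_Y𝓚_A(δ_xA)|₀` and proves both); `hFR2` = «FR₂-lite» — OPEN; at `Y = 0` (2) reads `0 = gd(κ0)`-type
consistency and `hFR2` forces `0 ≤ C`; nothing eventual.
HONEST SCOPE.  Norm bookkeeping; (2) and FR₂-lite are NOT proved here; nothing of (q-gauge)-core beyond ✓p770618∕✓p772811, `hqG`, norm_G, EX, the crux or rung R3 is proved; the
Yang–Mills mass gap is NOT proved.

References: T. Bałaban, CMP **99** (1985) 389–434 [Balaban1985BackgroundPropagators] ((3.13) p.392, (3.14)–(3.16) and (3.19) p.393, (3.114)–(3.115) p.418); CMP **98** (1985) 17–51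
[Balaban1985Averaging] ((11) p.19, (97) p.32, Prop. 5 (157) p.42).
-/

set_option autoImplicit false

noncomputable section

open scoped BigOperators Matrix.Norms.L2Operator Matrix

namespace Summit.QuantumFields.YangMills.Theorems.Prop7AvgHessGaugeIdentityNormReading

open Literature.MathematicalPhysics.QuantumFieldTheory.Balaban1983to89
open Literature.MathematicalPhysics.QuantumFieldTheory.Balaban1983to89.T3ContinuumYM3Torus
open T3PrintedRegularMinimiser (RegPr)
open T3PrintedRegularOrbits (sites_eq)
open T3LevelShift (siteShift bondShift bondShift_src bondShift_tgt)
open T3SectALandauChart (bgUnits eta eta_pos)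
open T4Continuum T4ReflectionCone BlockAveraging AveragingRT
open B10Eq27TorusAxialLog (holT transl)
open B7Prop1Explicit (disp U1 mem_U1)
open B7TransferAnalyticMean (meanCLM)
open Summit.QuantumFields.YangMills.Theorems.Prop8Chart (emlIterU)
open Summit.QuantumFields.YangMills.Theorems.Prop7SectET3HilbertLetters (toL2 toL2S DL2)
open Summit.QuantumFields.YangMills.Theorems.Prop7SectET3DeltaOne (avgHess)
open Summit.QuantumFields.YangMills.Theorems.Prop7SymAvgTwSym (QTwS emlIterU_bgUnits_mem_U1_of_regPr)
open Summit.QuantumFields.YangMills.Theorems.Prop7AvgHessGaugeT1Row (sum_norm_src_add_tgt_eq)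
open Summit.QuantumFields.YangMills.Theorems.Prop7TJDivGaugeDirDict (hqG_row_of_gaugeDir_column hqG_of_gaugeDir_column_family)
open Summit.QuantumFields.YangMills.Theorems.Prop7AvgHessGaugeT2Letters (gaugeDir_column_of_identity_and_FR2)

/-! ## §1 Letters -/

section Letters

/-- `‖2⁻¹•(Pσ − σP)‖ ≤ ‖P‖·‖σ‖`. [folklore] -/
theorem norm_half_comm_le (P σ : Matrix (Fin 2) (Fin 2) ℂ) : ‖(2 : ℂ)⁻¹ • (P * σ - σ * P)‖ ≤ ‖P‖ * ‖σ‖ := by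
  rw [norm_smul, norm_inv, Complex.norm_ofNat]
  have h1 : ‖P * σ - σ * P‖ ≤ 2 * (‖P‖ * ‖σ‖) := by
    calc ‖P * σ - σ * P‖ ≤ ‖P * σ‖ + ‖σ * P‖ := norm_sub_le _ _
      _ ≤ ‖P‖ * ‖σ‖ + ‖σ‖ * ‖P‖ := add_le_add (norm_mul_le _ _) (norm_mul_le _ _)
      _ = 2 * (‖P‖ * ‖σ‖) := by ring
  calc (2 : ℝ)⁻¹ * ‖P * σ - σ * P‖ ≤ (2 : ℝ)⁻¹ * (2 * (‖P‖ * ‖σ‖)) := mul_le_mul_of_nonneg_left h1 (by positivity)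
    _ = ‖P‖ * ‖σ‖ := by field_simp

/-- `‖E b E⁻¹‖ ≤ ‖b‖` for `E ∈ U1`. [folklore] -/
theorem norm_conj_le_of_mem_U1 {E : (Matrix (Fin 2) (Fin 2) ℂ)ˣ} (hE : E ∈ U1 (Matrix (Fin 2) (Fin 2) ℂ)) (b : Matrix (Fin 2) (Fin 2) ℂ) :
    ‖(E : Matrix (Fin 2) (Fin 2) ℂ) * b * ((E⁻¹ : (Matrix (Fin 2) (Fin 2) ℂ)ˣ) : Matrix (Fin 2) (Fin 2) ℂ)‖ ≤ ‖b‖ := by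
  obtain ⟨h1, h2⟩ := mem_U1.1 hE
  calc _ ≤ ‖(E : Matrix (Fin 2) (Fin 2) ℂ)‖ * ‖b‖ * ‖((E⁻¹ : (Matrix (Fin 2) (Fin 2) ℂ)ˣ) : Matrix (Fin 2) (Fin 2) ℂ)‖ :=
        (norm_mul_le _ _).trans (mul_le_mul_of_nonneg_right (norm_mul_le _ _) (norm_nonneg _))
    _ ≤ 1 * ‖b‖ * 1 := by gcongr
    _ = ‖b‖ := by ring

/-- `‖a + E b E⁻¹‖ ≤ ‖a‖ + ‖b‖` for `E ∈ U1`. [folklore] -/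
theorem norm_add_conj_le_of_mem_U1 {E : (Matrix (Fin 2) (Fin 2) ℂ)ˣ} (hE : E ∈ U1 (Matrix (Fin 2) (Fin 2) ℂ)) (a b : Matrix (Fin 2) (Fin 2) ℂ) :
    ‖a + (E : Matrix (Fin 2) (Fin 2) ℂ) * b * ((E⁻¹ : (Matrix (Fin 2) (Fin 2) ℂ)ˣ) : Matrix (Fin 2) (Fin 2) ℂ)‖ ≤ ‖a‖ + ‖b‖ :=
  (norm_add_le _ _).trans (add_le_add le_rfl (norm_conj_le_of_mem_U1 hE b))

/-- `‖a − E b E⁻¹‖ ≤ ‖a‖ + ‖b‖` for `E ∈ U1`. [folklore] -/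
theorem norm_sub_conj_le_of_mem_U1 {E : (Matrix (Fin 2) (Fin 2) ℂ)ˣ} (hE : E ∈ U1 (Matrix (Fin 2) (Fin 2) ℂ)) (a b : Matrix (Fin 2) (Fin 2) ℂ) :
    ‖a - (E : Matrix (Fin 2) (Fin 2) ℂ) * b * ((E⁻¹ : (Matrix (Fin 2) (Fin 2) ℂ)ˣ) : Matrix (Fin 2) (Fin 2) ℂ)‖ ≤ ‖a‖ + ‖b‖ :=
  (norm_sub_le _ _).trans (add_le_add le_rfl (norm_conj_le_of_mem_U1 hE b))

variable (F : T3Family) {n K : ℕ} (h : n ≤ K)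

/-- ★ **BOND-END MASS ON THE COMPARISON LATTICE**: `Σ_(c : PBond (F.P n) 0) (‖f ĉ.src‖ + ‖f ĉ.tgt‖) = 2·3·Σ_z ‖f z‖` for every `f` on `T⁽ᴷ⁾_(K−n)` (`ĉ = bondShift c`; ✓`sum_norm_src_add_tgt_eq`
on the member `F.P n`, carried along `siteShift`). [folklore] -/
theorem sum_norm_bondShift_ends_eq (f : Site (F.P K) (K - n) → Matrix (Fin 2) (Fin 2) ℂ) :
    ∑ c : PBond (F.P n) 0, (‖f (bondShift (sites_eq F n K h) c).src‖ + ‖f (bondShift (sites_eq F n K h) c).tgt‖) = 2 * 3 * ∑ z : Site (F.P K) (K - n), ‖f z‖ := by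
  have h1 : ∀ c : PBond (F.P n) 0, ‖f (bondShift (sites_eq F n K h) c).src‖ + ‖f (bondShift (sites_eq F n K h) c).tgt‖
      = ‖(fun y : Site (F.P n) 0 => f (siteShift (sites_eq F n K h) y)) c.src‖ + ‖(fun y : Site (F.P n) 0 => f (siteShift (sites_eq F n K h) y)) c.tgt‖ := by
    intro c; rw [bondShift_src, bondShift_tgt]; exact rfl
  rw [Finset.sum_congr rfl fun c _ => h1 c, sum_norm_src_add_tgt_eq (F := F) (K := n) (fun y : Site (F.P n) 0 => f (siteShift (sites_eq F n K h) y))]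
  congr 1
  exact Equiv.sum_comp (siteShift (sites_eq F n K h)) (fun z => ‖f z‖)

end Letters

/-! ## §2 `hId` (✓p772811 §3's letter, VERBATIM) from the pointwise identity (2) -/

section NormReading

variable {F : T3Family} {n K : ℕ} {h : n ≤ K} {c₀ : ℝ} [Fact (0 < c₀)]

/-- ★★★ **THE NORM READING OF S1-SPEC (2)**: `RegPr F n K ε₀ U₀`, `10¹²L³ε₀ ≤ 1`, and the POINTWISE identity (2) for the site-spike family — `h2`: for all `Y x A c`,
`avgHess U₀ Y (gd δ_xA)(c) = −2⁻¹•QTwS U₀ ([δ_xA(b₋) + U₀δ_xA(b₊)U₀⁻¹, Y b])(c) + 2⁻¹•[ns(ĉ₋) + E(ĉ)ns(ĉ₊)E(ĉ)⁻¹, QTwS U₀ Y (c)] + (κY(ĉ₋) − E(ĉ)κY(ĉ₊)E(ĉ)⁻¹)` with `E(ĉ) = Ū₀♭⁽ᵏ⁾(ĉ)`,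
`ns x A` the averaging sequence of the spike and `κY Y x A` the chart derivative of its frame-corrected coarse parameter (OPEN, displayed) ⟹ ✓`Prop7AvgHessGaugeT2Letters` §3's letter `hId`
VERBATIM with `MK Y x A := Σ_c (‖κY Y x A ĉ.src‖ + ‖κY Y x A ĉ.tgt‖)` — triangle inequality, `‖2⁻¹•[P, σ_c]‖ ≤ ‖P‖‖σ_c‖ ≤ (‖ns ĉ₋‖ + ‖ns ĉ₊‖)·‖QTwS U₀ Y‖_∞` (`E(ĉ) ∈ U1`), `2⁻¹ ≤ 1`.
[cite: Balaban1985BackgroundPropagators, (3.114)–(3.115) p.418, (3.14)–(3.16) and (3.19) p.393; Balaban1985Averaging, (97) p.32, Prop. 5 (157) p.42] -/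
theorem hId_of_pointwise_identity {ε₀ : ℝ} (hε₀ : 0 < ε₀) (hε12 : 10 ^ 12 * (F.L : ℝ) ^ 3 * ε₀ ≤ 1)
    (U₀ : GaugeField (F.P K) 0 (Matrix.specialUnitaryGroup (Fin 2) ℂ)) (hreg : RegPr F n K ε₀ U₀)
    (ns : Site (F.P K) 0 → Matrix (Fin 2) (Fin 2) ℂ → (j : ℕ) → Site (F.P K) j → Matrix (Fin 2) (Fin 2) ℂ)
    (κY : (PBond (F.P K) 0 → Matrix (Fin 2) (Fin 2) ℂ) → Site (F.P K) 0 → Matrix (Fin 2) (Fin 2) ℂ → Site (F.P K) (K - n) → Matrix (Fin 2) (Fin 2) ℂ)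
    (h2 : ∀ (Y : PBond (F.P K) 0 → Matrix (Fin 2) (Fin 2) ℂ) (x : Site (F.P K) 0) (A : Matrix (Fin 2) (Fin 2) ℂ) (c : PBond (F.P n) 0),
      avgHess F n K h U₀ Y (fun b : PBond (F.P K) 0 =>
          (Pi.single x A : Site (F.P K) 0 → Matrix (Fin 2) (Fin 2) ℂ) b.src
            - ((bgUnits F K U₀ b : (Matrix (Fin 2) (Fin 2) ℂ)ˣ) : Matrix (Fin 2) (Fin 2) ℂ) * (Pi.single x A : Site (F.P K) 0 → Matrix (Fin 2) (Fin 2) ℂ) b.tgt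
              * (((bgUnits F K U₀ b)⁻¹ : (Matrix (Fin 2) (Fin 2) ℂ)ˣ) : Matrix (Fin 2) (Fin 2) ℂ)) c
        = -((2 : ℂ)⁻¹ • QTwS F n K h U₀ (fun b : PBond (F.P K) 0 =>
            ((Pi.single x A : Site (F.P K) 0 → Matrix (Fin 2) (Fin 2) ℂ) b.src
                + ((bgUnits F K U₀ b : (Matrix (Fin 2) (Fin 2) ℂ)ˣ) : Matrix (Fin 2) (Fin 2) ℂ) * (Pi.single x A : Site (F.P K) 0 → Matrix (Fin 2) (Fin 2) ℂ) b.tgt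
                  * (((bgUnits F K U₀ b)⁻¹ : (Matrix (Fin 2) (Fin 2) ℂ)ˣ) : Matrix (Fin 2) (Fin 2) ℂ)) * Y b
              - Y b * ((Pi.single x A : Site (F.P K) 0 → Matrix (Fin 2) (Fin 2) ℂ) b.src
                + ((bgUnits F K U₀ b : (Matrix (Fin 2) (Fin 2) ℂ)ˣ) : Matrix (Fin 2) (Fin 2) ℂ) * (Pi.single x A : Site (F.P K) 0 → Matrix (Fin 2) (Fin 2) ℂ) b.tgt
                  * (((bgUnits F K U₀ b)⁻¹ : (Matrix (Fin 2) (Fin 2) ℂ)ˣ) : Matrix (Fin 2) (Fin 2) ℂ))) c)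
          + (2 : ℂ)⁻¹ • ((ns x A (K - n) (bondShift (sites_eq F n K h) c).src + ((emlIterU (K - n) (bgUnits F K U₀) (bondShift (sites_eq F n K h) c) : (Matrix (Fin 2) (Fin 2) ℂ)ˣ) : Matrix (Fin 2) (Fin 2) ℂ) * ns x A (K - n) (bondShift (sites_eq F n K h) c).tgt * (((emlIterU (K - n) (bgUnits F K U₀) (bondShift (sites_eq F n K h) c))⁻¹ : (Matrix (Fin 2) (Fin 2) ℂ)ˣ) : Matrix (Fin 2) (Fin 2) ℂ)) * QTwS F n K h U₀ Y c
              - QTwS F n K h U₀ Y c * (ns x A (K - n) (bondShift (sites_eq F n K h) c).src + ((emlIterU (K - n) (bgUnits F K U₀) (bondShift (sites_eq F n K h) c) : (Matrix (Fin 2) (Fin 2) ℂ)ˣ) : Matrix (Fin 2) (Fin 2) ℂ) * ns x A (K - n) (bondShift (sites_eq F n K h) c).tgt * (((emlIterU (K - n) (bgUnits F K U₀) (bondShift (sites_eq F n K h) c))⁻¹ : (Matrix (Fin 2) (Fin 2) ℂ)ˣ) : Matrix (Fin 2) (Fin 2) ℂ)))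
          + (κY Y x A (bondShift (sites_eq F n K h) c).src - ((emlIterU (K - n) (bgUnits F K U₀) (bondShift (sites_eq F n K h) c) : (Matrix (Fin 2) (Fin 2) ℂ)ˣ) : Matrix (Fin 2) (Fin 2) ℂ) * κY Y x A (bondShift (sites_eq F n K h) c).tgt * (((emlIterU (K - n) (bgUnits F K U₀) (bondShift (sites_eq F n K h) c))⁻¹ : (Matrix (Fin 2) (Fin 2) ℂ)ˣ) : Matrix (Fin 2) (Fin 2) ℂ))) :
    ∀ (Y : PBond (F.P K) 0 → Matrix (Fin 2) (Fin 2) ℂ) (x : Site (F.P K) 0) (A : Matrix (Fin 2) (Fin 2) ℂ),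
      ∑ c : PBond (F.P n) 0, ‖avgHess F n K h U₀ Y (fun b : PBond (F.P K) 0 =>
          (Pi.single x A : Site (F.P K) 0 → Matrix (Fin 2) (Fin 2) ℂ) b.src
            - ((bgUnits F K U₀ b : (Matrix (Fin 2) (Fin 2) ℂ)ˣ) : Matrix (Fin 2) (Fin 2) ℂ) * (Pi.single x A : Site (F.P K) 0 → Matrix (Fin 2) (Fin 2) ℂ) b.tgt
              * (((bgUnits F K U₀ b)⁻¹ : (Matrix (Fin 2) (Fin 2) ℂ)ˣ) : Matrix (Fin 2) (Fin 2) ℂ)) c‖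
        ≤ ∑ c : PBond (F.P n) 0, ‖QTwS F n K h U₀ (fun b : PBond (F.P K) 0 =>
            ((Pi.single x A : Site (F.P K) 0 → Matrix (Fin 2) (Fin 2) ℂ) b.src
                + ((bgUnits F K U₀ b : (Matrix (Fin 2) (Fin 2) ℂ)ˣ) : Matrix (Fin 2) (Fin 2) ℂ) * (Pi.single x A : Site (F.P K) 0 → Matrix (Fin 2) (Fin 2) ℂ) b.tgt
                  * (((bgUnits F K U₀ b)⁻¹ : (Matrix (Fin 2) (Fin 2) ℂ)ˣ) : Matrix (Fin 2) (Fin 2) ℂ)) * Y b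
              - Y b * ((Pi.single x A : Site (F.P K) 0 → Matrix (Fin 2) (Fin 2) ℂ) b.src
                + ((bgUnits F K U₀ b : (Matrix (Fin 2) (Fin 2) ℂ)ˣ) : Matrix (Fin 2) (Fin 2) ℂ) * (Pi.single x A : Site (F.P K) 0 → Matrix (Fin 2) (Fin 2) ℂ) b.tgt
                  * (((bgUnits F K U₀ b)⁻¹ : (Matrix (Fin 2) (Fin 2) ℂ)ˣ) : Matrix (Fin 2) (Fin 2) ℂ))) c‖
          + ‖QTwS F n K h U₀ Y‖ * (∑ c : PBond (F.P n) 0, (‖ns x A (K - n) (bondShift (sites_eq F n K h) c).src‖ + ‖ns x A (K - n) (bondShift (sites_eq F n K h) c).tgt‖)) + (∑ c : PBond (F.P n) 0, (‖κY Y x A (bondShift (sites_eq F n K h) c).src‖ + ‖κY Y x A (bondShift (sites_eq F n K h) c).tgt‖)) := by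
  intro Y x A
  have hε7 : 10 ^ 7 * (F.L : ℝ) ^ 3 * ε₀ ≤ 1 := by
    have : 0 ≤ (F.L : ℝ) ^ 3 * ε₀ := by positivity
    nlinarith
  have hE : ∀ c : PBond (F.P n) 0, emlIterU (K - n) (bgUnits F K U₀) (bondShift (sites_eq F n K h) c) ∈ U1 (Matrix (Fin 2) (Fin 2) ℂ) :=
    fun c => emlIterU_bgUnits_mem_U1_of_regPr F hε₀ hε7 hreg le_rfl _
  -- pointwise
  have hpt : ∀ c : PBond (F.P n) 0, ‖avgHess F n K h U₀ Y (fun b : PBond (F.P K) 0 =>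
          (Pi.single x A : Site (F.P K) 0 → Matrix (Fin 2) (Fin 2) ℂ) b.src
            - ((bgUnits F K U₀ b : (Matrix (Fin 2) (Fin 2) ℂ)ˣ) : Matrix (Fin 2) (Fin 2) ℂ) * (Pi.single x A : Site (F.P K) 0 → Matrix (Fin 2) (Fin 2) ℂ) b.tgt
              * (((bgUnits F K U₀ b)⁻¹ : (Matrix (Fin 2) (Fin 2) ℂ)ˣ) : Matrix (Fin 2) (Fin 2) ℂ)) c‖
      ≤ ‖QTwS F n K h U₀ (fun b : PBond (F.P K) 0 =>
            ((Pi.single x A : Site (F.P K) 0 → Matrix (Fin 2) (Fin 2) ℂ) b.src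
                + ((bgUnits F K U₀ b : (Matrix (Fin 2) (Fin 2) ℂ)ˣ) : Matrix (Fin 2) (Fin 2) ℂ) * (Pi.single x A : Site (F.P K) 0 → Matrix (Fin 2) (Fin 2) ℂ) b.tgt
                  * (((bgUnits F K U₀ b)⁻¹ : (Matrix (Fin 2) (Fin 2) ℂ)ˣ) : Matrix (Fin 2) (Fin 2) ℂ)) * Y b
              - Y b * ((Pi.single x A : Site (F.P K) 0 → Matrix (Fin 2) (Fin 2) ℂ) b.src
                + ((bgUnits F K U₀ b : (Matrix (Fin 2) (Fin 2) ℂ)ˣ) : Matrix (Fin 2) (Fin 2) ℂ) * (Pi.single x A : Site (F.P K) 0 → Matrix (Fin 2) (Fin 2) ℂ) b.tgt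
                  * (((bgUnits F K U₀ b)⁻¹ : (Matrix (Fin 2) (Fin 2) ℂ)ˣ) : Matrix (Fin 2) (Fin 2) ℂ))) c‖
        + ‖QTwS F n K h U₀ Y‖ * (‖ns x A (K - n) (bondShift (sites_eq F n K h) c).src‖ + ‖ns x A (K - n) (bondShift (sites_eq F n K h) c).tgt‖) + (‖κY Y x A (bondShift (sites_eq F n K h) c).src‖ + ‖κY Y x A (bondShift (sites_eq F n K h) c).tgt‖) := by
    intro c
    rw [h2 Y x A c]
    have hσ : ‖QTwS F n K h U₀ Y c‖ ≤ ‖QTwS F n K h U₀ Y‖ := norm_le_pi_norm _ c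
    have hP : ‖(ns x A (K - n) (bondShift (sites_eq F n K h) c).src + ((emlIterU (K - n) (bgUnits F K U₀) (bondShift (sites_eq F n K h) c) : (Matrix (Fin 2) (Fin 2) ℂ)ˣ) : Matrix (Fin 2) (Fin 2) ℂ) * ns x A (K - n) (bondShift (sites_eq F n K h) c).tgt * (((emlIterU (K - n) (bgUnits F K U₀) (bondShift (sites_eq F n K h) c))⁻¹ : (Matrix (Fin 2) (Fin 2) ℂ)ˣ) : Matrix (Fin 2) (Fin 2) ℂ))‖ ≤ ‖ns x A (K - n) (bondShift (sites_eq F n K h) c).src‖ + ‖ns x A (K - n) (bondShift (sites_eq F n K h) c).tgt‖ := norm_add_conj_le_of_mem_U1 (hE c) _ _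
    have hT1 : ‖-((2 : ℂ)⁻¹ • QTwS F n K h U₀ (fun b : PBond (F.P K) 0 =>
            ((Pi.single x A : Site (F.P K) 0 → Matrix (Fin 2) (Fin 2) ℂ) b.src
                + ((bgUnits F K U₀ b : (Matrix (Fin 2) (Fin 2) ℂ)ˣ) : Matrix (Fin 2) (Fin 2) ℂ) * (Pi.single x A : Site (F.P K) 0 → Matrix (Fin 2) (Fin 2) ℂ) b.tgt
                  * (((bgUnits F K U₀ b)⁻¹ : (Matrix (Fin 2) (Fin 2) ℂ)ˣ) : Matrix (Fin 2) (Fin 2) ℂ)) * Y b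
              - Y b * ((Pi.single x A : Site (F.P K) 0 → Matrix (Fin 2) (Fin 2) ℂ) b.src
                + ((bgUnits F K U₀ b : (Matrix (Fin 2) (Fin 2) ℂ)ˣ) : Matrix (Fin 2) (Fin 2) ℂ) * (Pi.single x A : Site (F.P K) 0 → Matrix (Fin 2) (Fin 2) ℂ) b.tgt
                  * (((bgUnits F K U₀ b)⁻¹ : (Matrix (Fin 2) (Fin 2) ℂ)ˣ) : Matrix (Fin 2) (Fin 2) ℂ))) c)‖ ≤ ‖QTwS F n K h U₀ (fun b : PBond (F.P K) 0 =>
            ((Pi.single x A : Site (F.P K) 0 → Matrix (Fin 2) (Fin 2) ℂ) b.src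
                + ((bgUnits F K U₀ b : (Matrix (Fin 2) (Fin 2) ℂ)ˣ) : Matrix (Fin 2) (Fin 2) ℂ) * (Pi.single x A : Site (F.P K) 0 → Matrix (Fin 2) (Fin 2) ℂ) b.tgt
                  * (((bgUnits F K U₀ b)⁻¹ : (Matrix (Fin 2) (Fin 2) ℂ)ˣ) : Matrix (Fin 2) (Fin 2) ℂ)) * Y b
              - Y b * ((Pi.single x A : Site (F.P K) 0 → Matrix (Fin 2) (Fin 2) ℂ) b.src
                + ((bgUnits F K U₀ b : (Matrix (Fin 2) (Fin 2) ℂ)ˣ) : Matrix (Fin 2) (Fin 2) ℂ) * (Pi.single x A : Site (F.P K) 0 → Matrix (Fin 2) (Fin 2) ℂ) b.tgt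
                  * (((bgUnits F K U₀ b)⁻¹ : (Matrix (Fin 2) (Fin 2) ℂ)ˣ) : Matrix (Fin 2) (Fin 2) ℂ))) c‖ := by
      rw [norm_neg, norm_smul, norm_inv, Complex.norm_ofNat]
      have h0 : 0 ≤ ‖QTwS F n K h U₀ (fun b : PBond (F.P K) 0 =>
            ((Pi.single x A : Site (F.P K) 0 → Matrix (Fin 2) (Fin 2) ℂ) b.src
                + ((bgUnits F K U₀ b : (Matrix (Fin 2) (Fin 2) ℂ)ˣ) : Matrix (Fin 2) (Fin 2) ℂ) * (Pi.single x A : Site (F.P K) 0 → Matrix (Fin 2) (Fin 2) ℂ) b.tgt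
                  * (((bgUnits F K U₀ b)⁻¹ : (Matrix (Fin 2) (Fin 2) ℂ)ˣ) : Matrix (Fin 2) (Fin 2) ℂ)) * Y b
              - Y b * ((Pi.single x A : Site (F.P K) 0 → Matrix (Fin 2) (Fin 2) ℂ) b.src
                + ((bgUnits F K U₀ b : (Matrix (Fin 2) (Fin 2) ℂ)ˣ) : Matrix (Fin 2) (Fin 2) ℂ) * (Pi.single x A : Site (F.P K) 0 → Matrix (Fin 2) (Fin 2) ℂ) b.tgt
                  * (((bgUnits F K U₀ b)⁻¹ : (Matrix (Fin 2) (Fin 2) ℂ)ˣ) : Matrix (Fin 2) (Fin 2) ℂ))) c‖ := norm_nonneg _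
      nlinarith
    have hT2 : ‖(2 : ℂ)⁻¹ • ((ns x A (K - n) (bondShift (sites_eq F n K h) c).src + ((emlIterU (K - n) (bgUnits F K U₀) (bondShift (sites_eq F n K h) c) : (Matrix (Fin 2) (Fin 2) ℂ)ˣ) : Matrix (Fin 2) (Fin 2) ℂ) * ns x A (K - n) (bondShift (sites_eq F n K h) c).tgt * (((emlIterU (K - n) (bgUnits F K U₀) (bondShift (sites_eq F n K h) c))⁻¹ : (Matrix (Fin 2) (Fin 2) ℂ)ˣ) : Matrix (Fin 2) (Fin 2) ℂ)) * QTwS F n K h U₀ Y c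
              - QTwS F n K h U₀ Y c * (ns x A (K - n) (bondShift (sites_eq F n K h) c).src + ((emlIterU (K - n) (bgUnits F K U₀) (bondShift (sites_eq F n K h) c) : (Matrix (Fin 2) (Fin 2) ℂ)ˣ) : Matrix (Fin 2) (Fin 2) ℂ) * ns x A (K - n) (bondShift (sites_eq F n K h) c).tgt * (((emlIterU (K - n) (bgUnits F K U₀) (bondShift (sites_eq F n K h) c))⁻¹ : (Matrix (Fin 2) (Fin 2) ℂ)ˣ) : Matrix (Fin 2) (Fin 2) ℂ)))‖
        ≤ ‖QTwS F n K h U₀ Y‖ * (‖ns x A (K - n) (bondShift (sites_eq F n K h) c).src‖ + ‖ns x A (K - n) (bondShift (sites_eq F n K h) c).tgt‖) := by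
      refine (norm_half_comm_le _ _).trans ?_
      rw [mul_comm]
      exact mul_le_mul hσ hP (norm_nonneg _) (norm_nonneg _)
    have hT3 : ‖κY Y x A (bondShift (sites_eq F n K h) c).src - ((emlIterU (K - n) (bgUnits F K U₀) (bondShift (sites_eq F n K h) c) : (Matrix (Fin 2) (Fin 2) ℂ)ˣ) : Matrix (Fin 2) (Fin 2) ℂ) * κY Y x A (bondShift (sites_eq F n K h) c).tgt * (((emlIterU (K - n) (bgUnits F K U₀) (bondShift (sites_eq F n K h) c))⁻¹ : (Matrix (Fin 2) (Fin 2) ℂ)ˣ) : Matrix (Fin 2) (Fin 2) ℂ)‖ ≤ ‖κY Y x A (bondShift (sites_eq F n K h) c).src‖ + ‖κY Y x A (bondShift (sites_eq F n K h) c).tgt‖ := norm_sub_conj_le_of_mem_U1 (hE c) _ _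
    exact ((norm_add_le _ _).trans (add_le_add ((norm_add_le _ _).trans (add_le_add hT1 hT2)) hT3))
  -- summed over the coarse bonds
  refine (Finset.sum_le_sum fun c _ => hpt c).trans (le_of_eq ?_)
  rw [Finset.sum_add_distrib, Finset.sum_add_distrib, Finset.mul_sum]

end NormReading

/-! ## §3 The core column and `hqG`'s member text from (2) pointwise + «FR₂-lite» in site-mass form -/

section Core

variable {F : T3Family} {n K : ℕ} {h : n ≤ K} {c₀ : ℝ} [Fact (0 < c₀)]

/-- ★★★ **THE (q-gauge)-CORE COLUMN FROM (2) POINTWISE AND «FR₂-lite» (SITE MASS)**: `U₀ ∈ 𝔘_k(ε₀)` in the (COL) windows, the averaging-sequence family `ns` of the spikes (`h0`, `hsucc`), the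
pointwise identity (2) (`h2`, OPEN) and `hFR2 : Σ_z ‖κY Y x A z‖ ≤ C·((F.L:ℝ)^(K−n))⁻¹^2·s·‖A‖` whenever `sup‖Y‖ ≤ s` («FR₂-lite», OPEN) ⟹
`Σ_y ‖avgHess U₀ Y (gd(δ_xA)) y‖ ≤ (240 + 6C)·((F.L:ℝ)^(K−n))⁻¹^2·s·‖A‖` — §2 ∘ ✓`Prop7AvgHessGaugeT2Letters.gaugeDir_column_of_identity_and_FR2` with `C₃ := 6C` (§1 bond-end mass).
[cite: Balaban1985BackgroundPropagators, (3.114)–(3.115) p.418, (3.16) and (3.19) p.393; Balaban1985Averaging, (97) p.32, Prop. 5 (157) p.42] -/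
theorem gaugeDir_column_of_pointwise_identity_and_FR2 {ε₀ : ℝ} (hε₀ : 0 < ε₀) (hε : 10 ^ 10 * (F.L : ℝ) ^ 6 * ε₀ ≤ 1) (hε12 : 10 ^ 12 * (F.L : ℝ) ^ 3 * ε₀ ≤ 1)
    (U₀ : GaugeField (F.P K) 0 (Matrix.specialUnitaryGroup (Fin 2) ℂ)) (hreg : RegPr F n K ε₀ U₀)
    (ns : Site (F.P K) 0 → Matrix (Fin 2) (Fin 2) ℂ → (j : ℕ) → Site (F.P K) j → Matrix (Fin 2) (Fin 2) ℂ)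
    (h0 : ∀ (x : Site (F.P K) 0) (A : Matrix (Fin 2) (Fin 2) ℂ), ns x A 0 = Pi.single x A)
    (hsucc : ∀ (x : Site (F.P K) 0) (A : Matrix (Fin 2) (Fin 2) ℂ) (j : ℕ) (y : Site (F.P K) (j + 1)), ns x A (j + 1) y = ns x A j (emb y) - meanCLM (Idx (F.P K)) (Matrix (Fin 2) (Fin 2) ℂ) fun r : Idx (F.P K) =>
        ns x A j (emb y) - ((holT (emlIterU j (bgUnits F K U₀)) (emb y) (stairWord r.2.1 (off r.1)) : (Matrix (Fin 2) (Fin 2) ℂ)ˣ) : Matrix (Fin 2) (Fin 2) ℂ) *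
          ns x A j (transl (emb y) (disp (stairWord r.2.1 (off r.1)))) * (((holT (emlIterU j (bgUnits F K U₀)) (emb y) (stairWord r.2.1 (off r.1)))⁻¹ : (Matrix (Fin 2) (Fin 2) ℂ)ˣ) : Matrix (Fin 2) (Fin 2) ℂ))
    (κY : (PBond (F.P K) 0 → Matrix (Fin 2) (Fin 2) ℂ) → Site (F.P K) 0 → Matrix (Fin 2) (Fin 2) ℂ → Site (F.P K) (K - n) → Matrix (Fin 2) (Fin 2) ℂ)
    (h2 : ∀ (Y : PBond (F.P K) 0 → Matrix (Fin 2) (Fin 2) ℂ) (x : Site (F.P K) 0) (A : Matrix (Fin 2) (Fin 2) ℂ) (c : PBond (F.P n) 0),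
      avgHess F n K h U₀ Y (fun b : PBond (F.P K) 0 =>
          (Pi.single x A : Site (F.P K) 0 → Matrix (Fin 2) (Fin 2) ℂ) b.src
            - ((bgUnits F K U₀ b : (Matrix (Fin 2) (Fin 2) ℂ)ˣ) : Matrix (Fin 2) (Fin 2) ℂ) * (Pi.single x A : Site (F.P K) 0 → Matrix (Fin 2) (Fin 2) ℂ) b.tgt
              * (((bgUnits F K U₀ b)⁻¹ : (Matrix (Fin 2) (Fin 2) ℂ)ˣ) : Matrix (Fin 2) (Fin 2) ℂ)) c
        = -((2 : ℂ)⁻¹ • QTwS F n K h U₀ (fun b : PBond (F.P K) 0 =>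
            ((Pi.single x A : Site (F.P K) 0 → Matrix (Fin 2) (Fin 2) ℂ) b.src
                + ((bgUnits F K U₀ b : (Matrix (Fin 2) (Fin 2) ℂ)ˣ) : Matrix (Fin 2) (Fin 2) ℂ) * (Pi.single x A : Site (F.P K) 0 → Matrix (Fin 2) (Fin 2) ℂ) b.tgt
                  * (((bgUnits F K U₀ b)⁻¹ : (Matrix (Fin 2) (Fin 2) ℂ)ˣ) : Matrix (Fin 2) (Fin 2) ℂ)) * Y b
              - Y b * ((Pi.single x A : Site (F.P K) 0 → Matrix (Fin 2) (Fin 2) ℂ) b.src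
                + ((bgUnits F K U₀ b : (Matrix (Fin 2) (Fin 2) ℂ)ˣ) : Matrix (Fin 2) (Fin 2) ℂ) * (Pi.single x A : Site (F.P K) 0 → Matrix (Fin 2) (Fin 2) ℂ) b.tgt
                  * (((bgUnits F K U₀ b)⁻¹ : (Matrix (Fin 2) (Fin 2) ℂ)ˣ) : Matrix (Fin 2) (Fin 2) ℂ))) c)
          + (2 : ℂ)⁻¹ • ((ns x A (K - n) (bondShift (sites_eq F n K h) c).src + ((emlIterU (K - n) (bgUnits F K U₀) (bondShift (sites_eq F n K h) c) : (Matrix (Fin 2) (Fin 2) ℂ)ˣ) : Matrix (Fin 2) (Fin 2) ℂ) * ns x A (K - n) (bondShift (sites_eq F n K h) c).tgt * (((emlIterU (K - n) (bgUnits F K U₀) (bondShift (sites_eq F n K h) c))⁻¹ : (Matrix (Fin 2) (Fin 2) ℂ)ˣ) : Matrix (Fin 2) (Fin 2) ℂ)) * QTwS F n K h U₀ Y c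
              - QTwS F n K h U₀ Y c * (ns x A (K - n) (bondShift (sites_eq F n K h) c).src + ((emlIterU (K - n) (bgUnits F K U₀) (bondShift (sites_eq F n K h) c) : (Matrix (Fin 2) (Fin 2) ℂ)ˣ) : Matrix (Fin 2) (Fin 2) ℂ) * ns x A (K - n) (bondShift (sites_eq F n K h) c).tgt * (((emlIterU (K - n) (bgUnits F K U₀) (bondShift (sites_eq F n K h) c))⁻¹ : (Matrix (Fin 2) (Fin 2) ℂ)ˣ) : Matrix (Fin 2) (Fin 2) ℂ)))
          + (κY Y x A (bondShift (sites_eq F n K h) c).src - ((emlIterU (K - n) (bgUnits F K U₀) (bondShift (sites_eq F n K h) c) : (Matrix (Fin 2) (Fin 2) ℂ)ˣ) : Matrix (Fin 2) (Fin 2) ℂ) * κY Y x A (bondShift (sites_eq F n K h) c).tgt * (((emlIterU (K - n) (bgUnits F K U₀) (bondShift (sites_eq F n K h) c))⁻¹ : (Matrix (Fin 2) (Fin 2) ℂ)ˣ) : Matrix (Fin 2) (Fin 2) ℂ)))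
    {C : ℝ} (hFR2 : ∀ (Y : PBond (F.P K) 0 → Matrix (Fin 2) (Fin 2) ℂ) (s : ℝ) (x : Site (F.P K) 0) (A : Matrix (Fin 2) (Fin 2) ℂ), (∀ b, ‖Y b‖ ≤ s) →
      ∑ z : Site (F.P K) (K - n), ‖κY Y x A z‖ ≤ C * ((F.L : ℝ) ^ (K - n))⁻¹ ^ 2 * s * ‖A‖)
    (Y : PBond (F.P K) 0 → Matrix (Fin 2) (Fin 2) ℂ) (s : ℝ) (x : Site (F.P K) 0) (A : Matrix (Fin 2) (Fin 2) ℂ) (hY : ∀ b, ‖Y b‖ ≤ s) :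
    ∑ c : PBond (F.P n) 0, ‖avgHess F n K h U₀ Y (fun b : PBond (F.P K) 0 =>
          (Pi.single x A : Site (F.P K) 0 → Matrix (Fin 2) (Fin 2) ℂ) b.src
            - ((bgUnits F K U₀ b : (Matrix (Fin 2) (Fin 2) ℂ)ˣ) : Matrix (Fin 2) (Fin 2) ℂ) * (Pi.single x A : Site (F.P K) 0 → Matrix (Fin 2) (Fin 2) ℂ) b.tgt
              * (((bgUnits F K U₀ b)⁻¹ : (Matrix (Fin 2) (Fin 2) ℂ)ˣ) : Matrix (Fin 2) (Fin 2) ℂ)) c‖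
      ≤ (240 + 6 * C) * ((F.L : ℝ) ^ (K - n))⁻¹ ^ 2 * s * ‖A‖ :=
  gaugeDir_column_of_identity_and_FR2 (h := h) hε₀ hε hε12 U₀ hreg ns h0 hsucc (C₃ := 6 * C)
    (fun Y x A => (∑ c : PBond (F.P n) 0, (‖κY Y x A (bondShift (sites_eq F n K h) c).src‖ + ‖κY Y x A (bondShift (sites_eq F n K h) c).tgt‖)))
    (fun Y s x A hY => by
      rw [sum_norm_bondShift_ends_eq F h (κY Y x A)]
      have h6 : (2 : ℝ) * 3 = 6 := by norm_num
      rw [h6]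
      calc 6 * ∑ z : Site (F.P K) (K - n), ‖κY Y x A z‖ ≤ 6 * (C * ((F.L : ℝ) ^ (K - n))⁻¹ ^ 2 * s * ‖A‖) :=
            mul_le_mul_of_nonneg_left (hFR2 Y s x A hY) (by norm_num)
        _ = 6 * C * ((F.L : ℝ) ^ (K - n))⁻¹ ^ 2 * s * ‖A‖ := by ring)
    (hId_of_pointwise_identity (h := h) hε₀ hε12 U₀ hreg ns κY h2) Y s x A hY

/-- ★★★ **✓p768852's MEMBER ROW `hQG` FROM (2) POINTWISE AND «FR₂-lite» (SITE MASS)**: §3 ∘ ✓`Prop7TJDivGaugeDirDict.hqG_row_of_gaugeDir_column` — for every bounded `X′` and site spike,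
`Σ_y ‖avgHess U₀ X′ (toL2⁻¹(D_(U₀)(toL2S(δ_xA)))) y‖ ≤ η⁻¹·((240 + 6C)·ℓ⁻²)·s′·‖A‖`. [cite: Balaban1985BackgroundPropagators, (3.114)–(3.115) p.418, (3.19) p.393; Balaban1985Averaging, Prop. 5 (157) p.42] -/
theorem hqG_member_of_pointwise_identity_and_FR2 {ε₀ : ℝ} (hε₀ : 0 < ε₀) (hε : 10 ^ 10 * (F.L : ℝ) ^ 6 * ε₀ ≤ 1) (hε12 : 10 ^ 12 * (F.L : ℝ) ^ 3 * ε₀ ≤ 1)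
    (U₀ : GaugeField (F.P K) 0 (Matrix.specialUnitaryGroup (Fin 2) ℂ)) (hreg : RegPr F n K ε₀ U₀)
    (ns : Site (F.P K) 0 → Matrix (Fin 2) (Fin 2) ℂ → (j : ℕ) → Site (F.P K) j → Matrix (Fin 2) (Fin 2) ℂ)
    (h0 : ∀ (x : Site (F.P K) 0) (A : Matrix (Fin 2) (Fin 2) ℂ), ns x A 0 = Pi.single x A)
    (hsucc : ∀ (x : Site (F.P K) 0) (A : Matrix (Fin 2) (Fin 2) ℂ) (j : ℕ) (y : Site (F.P K) (j + 1)), ns x A (j + 1) y = ns x A j (emb y) - meanCLM (Idx (F.P K)) (Matrix (Fin 2) (Fin 2) ℂ) fun r : Idx (F.P K) =>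
        ns x A j (emb y) - ((holT (emlIterU j (bgUnits F K U₀)) (emb y) (stairWord r.2.1 (off r.1)) : (Matrix (Fin 2) (Fin 2) ℂ)ˣ) : Matrix (Fin 2) (Fin 2) ℂ) *
          ns x A j (transl (emb y) (disp (stairWord r.2.1 (off r.1)))) * (((holT (emlIterU j (bgUnits F K U₀)) (emb y) (stairWord r.2.1 (off r.1)))⁻¹ : (Matrix (Fin 2) (Fin 2) ℂ)ˣ) : Matrix (Fin 2) (Fin 2) ℂ))
    (κY : (PBond (F.P K) 0 → Matrix (Fin 2) (Fin 2) ℂ) → Site (F.P K) 0 → Matrix (Fin 2) (Fin 2) ℂ → Site (F.P K) (K - n) → Matrix (Fin 2) (Fin 2) ℂ)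
    (h2 : ∀ (Y : PBond (F.P K) 0 → Matrix (Fin 2) (Fin 2) ℂ) (x : Site (F.P K) 0) (A : Matrix (Fin 2) (Fin 2) ℂ) (c : PBond (F.P n) 0),
      avgHess F n K h U₀ Y (fun b : PBond (F.P K) 0 =>
          (Pi.single x A : Site (F.P K) 0 → Matrix (Fin 2) (Fin 2) ℂ) b.src
            - ((bgUnits F K U₀ b : (Matrix (Fin 2) (Fin 2) ℂ)ˣ) : Matrix (Fin 2) (Fin 2) ℂ) * (Pi.single x A : Site (F.P K) 0 → Matrix (Fin 2) (Fin 2) ℂ) b.tgt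
              * (((bgUnits F K U₀ b)⁻¹ : (Matrix (Fin 2) (Fin 2) ℂ)ˣ) : Matrix (Fin 2) (Fin 2) ℂ)) c
        = -((2 : ℂ)⁻¹ • QTwS F n K h U₀ (fun b : PBond (F.P K) 0 =>
            ((Pi.single x A : Site (F.P K) 0 → Matrix (Fin 2) (Fin 2) ℂ) b.src
                + ((bgUnits F K U₀ b : (Matrix (Fin 2) (Fin 2) ℂ)ˣ) : Matrix (Fin 2) (Fin 2) ℂ) * (Pi.single x A : Site (F.P K) 0 → Matrix (Fin 2) (Fin 2) ℂ) b.tgt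
                  * (((bgUnits F K U₀ b)⁻¹ : (Matrix (Fin 2) (Fin 2) ℂ)ˣ) : Matrix (Fin 2) (Fin 2) ℂ)) * Y b
              - Y b * ((Pi.single x A : Site (F.P K) 0 → Matrix (Fin 2) (Fin 2) ℂ) b.src
                + ((bgUnits F K U₀ b : (Matrix (Fin 2) (Fin 2) ℂ)ˣ) : Matrix (Fin 2) (Fin 2) ℂ) * (Pi.single x A : Site (F.P K) 0 → Matrix (Fin 2) (Fin 2) ℂ) b.tgt
                  * (((bgUnits F K U₀ b)⁻¹ : (Matrix (Fin 2) (Fin 2) ℂ)ˣ) : Matrix (Fin 2) (Fin 2) ℂ))) c)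
          + (2 : ℂ)⁻¹ • ((ns x A (K - n) (bondShift (sites_eq F n K h) c).src + ((emlIterU (K - n) (bgUnits F K U₀) (bondShift (sites_eq F n K h) c) : (Matrix (Fin 2) (Fin 2) ℂ)ˣ) : Matrix (Fin 2) (Fin 2) ℂ) * ns x A (K - n) (bondShift (sites_eq F n K h) c).tgt * (((emlIterU (K - n) (bgUnits F K U₀) (bondShift (sites_eq F n K h) c))⁻¹ : (Matrix (Fin 2) (Fin 2) ℂ)ˣ) : Matrix (Fin 2) (Fin 2) ℂ)) * QTwS F n K h U₀ Y c
              - QTwS F n K h U₀ Y c * (ns x A (K - n) (bondShift (sites_eq F n K h) c).src + ((emlIterU (K - n) (bgUnits F K U₀) (bondShift (sites_eq F n K h) c) : (Matrix (Fin 2) (Fin 2) ℂ)ˣ) : Matrix (Fin 2) (Fin 2) ℂ) * ns x A (K - n) (bondShift (sites_eq F n K h) c).tgt * (((emlIterU (K - n) (bgUnits F K U₀) (bondShift (sites_eq F n K h) c))⁻¹ : (Matrix (Fin 2) (Fin 2) ℂ)ˣ) : Matrix (Fin 2) (Fin 2) ℂ)))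
          + (κY Y x A (bondShift (sites_eq F n K h) c).src - ((emlIterU (K - n) (bgUnits F K U₀) (bondShift (sites_eq F n K h) c) : (Matrix (Fin 2) (Fin 2) ℂ)ˣ) : Matrix (Fin 2) (Fin 2) ℂ) * κY Y x A (bondShift (sites_eq F n K h) c).tgt * (((emlIterU (K - n) (bgUnits F K U₀) (bondShift (sites_eq F n K h) c))⁻¹ : (Matrix (Fin 2) (Fin 2) ℂ)ˣ) : Matrix (Fin 2) (Fin 2) ℂ)))
    {C : ℝ} (hFR2 : ∀ (Y : PBond (F.P K) 0 → Matrix (Fin 2) (Fin 2) ℂ) (s : ℝ) (x : Site (F.P K) 0) (A : Matrix (Fin 2) (Fin 2) ℂ), (∀ b, ‖Y b‖ ≤ s) →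
      ∑ z : Site (F.P K) (K - n), ‖κY Y x A z‖ ≤ C * ((F.L : ℝ) ^ (K - n))⁻¹ ^ 2 * s * ‖A‖) :
    ∀ (X' : PBond (F.P K) 0 → Matrix (Fin 2) (Fin 2) ℂ) (s' : ℝ) (x : Site (F.P K) 0) (A : Matrix (Fin 2) (Fin 2) ℂ), (∀ b, ‖X' b‖ ≤ s') →
      ∑ y : PBond (F.P n) 0, ‖avgHess F n K h U₀ X' ((toL2 F K c₀).symm (DL2 F n K c₀ U₀ (toL2S F K c₀ (Pi.single x A)))) y‖
        ≤ (eta F n K)⁻¹ * ((240 + 6 * C) * ((F.L : ℝ) ^ (K - n))⁻¹ ^ 2) * s' * ‖A‖ :=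
  hqG_row_of_gaugeDir_column (h := h) (c₀ := c₀) U₀ (fun X' s' x A hX' =>
    gaugeDir_column_of_pointwise_identity_and_FR2 (h := h) hε₀ hε hε12 U₀ hreg ns h0 hsucc κY h2 hFR2 X' s' x A hX')

end Core

/-! ## §4 ✓p768852's DISPLAYED family hypothesis `hqG`, VERBATIM, from the per-member ⟨(2) pointwise, FR₂-lite⟩ -/

section Family

/-- ★★★ **`hqG` OF ✓`Prop7TJDivRowOfColumns.hTJdiv_of_hHcol_hqG` — VERBATIM, with `qG L := 240 + 6·C L` — FROM THE PER-MEMBER POINTWISE IDENTITY (2) AND «FR₂-lite» (SITE MASS, constant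
`C L`)**: at every member `i : Idx L` (`1 < L`) and every `U₀ ∈ 𝔘_k(α L)` in the (COL) windows, §3 gives the core column with the L-ONLY constant `240 + 6·C L`, and
✓`Prop7TJDivGaugeDirDict.hqG_of_gaugeDir_column_family` turns it into the displayed row.  K-FREE iff `C` is.
[cite: Balaban1985BackgroundPropagators, (3.114)–(3.115) p.418, (3.16) and (3.19) p.393; Balaban1985Averaging, (97) p.32, Prop. 5 (157) p.42] -/
theorem hqG_of_pointwise_identity_and_FR2_family (α : ℕ → ℝ) (c₀ : ℕ → ℝ) [hc₀ : ∀ L : ℕ, Fact (0 < c₀ L)]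
    (hα0 : ∀ L : ℕ, 1 < L → 0 < α L) (hα10 : ∀ L : ℕ, 1 < L → 10 ^ 10 * (L : ℝ) ^ 6 * α L ≤ 1) (hα12 : ∀ L : ℕ, 1 < L → 10 ^ 12 * (L : ℝ) ^ 3 * α L ≤ 1)
    (ns : (L : ℕ) → (i : T3Thm1Carrier.Idx L) → GaugeField (i.1.1.P i.1.2.2) 0 (Matrix.specialUnitaryGroup (Fin 2) ℂ) →
      Site (i.1.1.P i.1.2.2) 0 → Matrix (Fin 2) (Fin 2) ℂ → (j : ℕ) → Site (i.1.1.P i.1.2.2) j → Matrix (Fin 2) (Fin 2) ℂ)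
    (h0 : ∀ (L : ℕ) (i : T3Thm1Carrier.Idx L) (U₀ : GaugeField (i.1.1.P i.1.2.2) 0 (Matrix.specialUnitaryGroup (Fin 2) ℂ)) (x : Site (i.1.1.P i.1.2.2) 0) (A : Matrix (Fin 2) (Fin 2) ℂ),
      ns L i U₀ x A 0 = Pi.single x A)
    (hsucc : ∀ (L : ℕ) (i : T3Thm1Carrier.Idx L) (U₀ : GaugeField (i.1.1.P i.1.2.2) 0 (Matrix.specialUnitaryGroup (Fin 2) ℂ)) (x : Site (i.1.1.P i.1.2.2) 0) (A : Matrix (Fin 2) (Fin 2) ℂ)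
      (j : ℕ) (y : Site (i.1.1.P i.1.2.2) (j + 1)), ns L i U₀ x A (j + 1) y = ns L i U₀ x A j (emb y) - meanCLM (Idx (i.1.1.P i.1.2.2)) (Matrix (Fin 2) (Fin 2) ℂ) fun r : Idx (i.1.1.P i.1.2.2) =>
        ns L i U₀ x A j (emb y) - ((holT (emlIterU j (bgUnits i.1.1 i.1.2.2 U₀)) (emb y) (stairWord r.2.1 (off r.1)) : (Matrix (Fin 2) (Fin 2) ℂ)ˣ) : Matrix (Fin 2) (Fin 2) ℂ) *
          ns L i U₀ x A j (transl (emb y) (disp (stairWord r.2.1 (off r.1)))) * (((holT (emlIterU j (bgUnits i.1.1 i.1.2.2 U₀)) (emb y) (stairWord r.2.1 (off r.1)))⁻¹ : (Matrix (Fin 2) (Fin 2) ℂ)ˣ) : Matrix (Fin 2) (Fin 2) ℂ))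
    (κY : (L : ℕ) → (i : T3Thm1Carrier.Idx L) → GaugeField (i.1.1.P i.1.2.2) 0 (Matrix.specialUnitaryGroup (Fin 2) ℂ) →
      (PBond (i.1.1.P i.1.2.2) 0 → Matrix (Fin 2) (Fin 2) ℂ) → Site (i.1.1.P i.1.2.2) 0 → Matrix (Fin 2) (Fin 2) ℂ → Site (i.1.1.P i.1.2.2) (i.1.2.2 - i.1.2.1) → Matrix (Fin 2) (Fin 2) ℂ)
    (h2 : ∀ (L : ℕ), 1 < L → ∀ (i : T3Thm1Carrier.Idx L) (U₀ : GaugeField (i.1.1.P i.1.2.2) 0 (Matrix.specialUnitaryGroup (Fin 2) ℂ)), RegPr i.1.1 i.1.2.1 i.1.2.2 (α L) U₀ →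
      ∀ (Y : PBond (i.1.1.P i.1.2.2) 0 → Matrix (Fin 2) (Fin 2) ℂ) (x : Site (i.1.1.P i.1.2.2) 0) (A : Matrix (Fin 2) (Fin 2) ℂ) (c : PBond (i.1.1.P i.1.2.1) 0),
      avgHess i.1.1 i.1.2.1 i.1.2.2 i.2.2.le U₀ Y (fun b : PBond (i.1.1.P i.1.2.2) 0 =>
          (Pi.single x A : Site (i.1.1.P i.1.2.2) 0 → Matrix (Fin 2) (Fin 2) ℂ) b.src
            - ((bgUnits i.1.1 i.1.2.2 U₀ b : (Matrix (Fin 2) (Fin 2) ℂ)ˣ) : Matrix (Fin 2) (Fin 2) ℂ) * (Pi.single x A : Site (i.1.1.P i.1.2.2) 0 → Matrix (Fin 2) (Fin 2) ℂ) b.tgt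
              * (((bgUnits i.1.1 i.1.2.2 U₀ b)⁻¹ : (Matrix (Fin 2) (Fin 2) ℂ)ˣ) : Matrix (Fin 2) (Fin 2) ℂ)) c
        = -((2 : ℂ)⁻¹ • QTwS i.1.1 i.1.2.1 i.1.2.2 i.2.2.le U₀ (fun b : PBond (i.1.1.P i.1.2.2) 0 =>
            ((Pi.single x A : Site (i.1.1.P i.1.2.2) 0 → Matrix (Fin 2) (Fin 2) ℂ) b.src
                + ((bgUnits i.1.1 i.1.2.2 U₀ b : (Matrix (Fin 2) (Fin 2) ℂ)ˣ) : Matrix (Fin 2) (Fin 2) ℂ) * (Pi.single x A : Site (i.1.1.P i.1.2.2) 0 → Matrix (Fin 2) (Fin 2) ℂ) b.tgt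
                  * (((bgUnits i.1.1 i.1.2.2 U₀ b)⁻¹ : (Matrix (Fin 2) (Fin 2) ℂ)ˣ) : Matrix (Fin 2) (Fin 2) ℂ)) * Y b
              - Y b * ((Pi.single x A : Site (i.1.1.P i.1.2.2) 0 → Matrix (Fin 2) (Fin 2) ℂ) b.src
                + ((bgUnits i.1.1 i.1.2.2 U₀ b : (Matrix (Fin 2) (Fin 2) ℂ)ˣ) : Matrix (Fin 2) (Fin 2) ℂ) * (Pi.single x A : Site (i.1.1.P i.1.2.2) 0 → Matrix (Fin 2) (Fin 2) ℂ) b.tgt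
                  * (((bgUnits i.1.1 i.1.2.2 U₀ b)⁻¹ : (Matrix (Fin 2) (Fin 2) ℂ)ˣ) : Matrix (Fin 2) (Fin 2) ℂ))) c)
          + (2 : ℂ)⁻¹ • ((ns L i U₀ x A (i.1.2.2 - i.1.2.1) (bondShift (sites_eq i.1.1 i.1.2.1 i.1.2.2 i.2.2.le) c).src + ((emlIterU (i.1.2.2 - i.1.2.1) (bgUnits i.1.1 i.1.2.2 U₀) (bondShift (sites_eq i.1.1 i.1.2.1 i.1.2.2 i.2.2.le) c) : (Matrix (Fin 2) (Fin 2) ℂ)ˣ) : Matrix (Fin 2) (Fin 2) ℂ) * ns L i U₀ x A (i.1.2.2 - i.1.2.1) (bondShift (sites_eq i.1.1 i.1.2.1 i.1.2.2 i.2.2.le) c).tgt * (((emlIterU (i.1.2.2 - i.1.2.1) (bgUnits i.1.1 i.1.2.2 U₀) (bondShift (sites_eq i.1.1 i.1.2.1 i.1.2.2 i.2.2.le) c))⁻¹ : (Matrix (Fin 2) (Fin 2) ℂ)ˣ) : Matrix (Fin 2) (Fin 2) ℂ)) * QTwS i.1.1 i.1.2.1 i.1.2.2 i.2.2.le U₀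 Y c
              - QTwS i.1.1 i.1.2.1 i.1.2.2 i.2.2.le U₀ Y c * (ns L i U₀ x A (i.1.2.2 - i.1.2.1) (bondShift (sites_eq i.1.1 i.1.2.1 i.1.2.2 i.2.2.le) c).src + ((emlIterU (i.1.2.2 - i.1.2.1) (bgUnits i.1.1 i.1.2.2 U₀) (bondShift (sites_eq i.1.1 i.1.2.1 i.1.2.2 i.2.2.le) c) : (Matrix (Fin 2) (Fin 2) ℂ)ˣ) : Matrix (Fin 2) (Fin 2) ℂ) * ns L i U₀ x A (i.1.2.2 - i.1.2.1) (bondShift (sites_eq i.1.1 i.1.2.1 i.1.2.2 i.2.2.le) c).tgt * (((emlIterU (i.1.2.2 - i.1.2.1) (bgUnits i.1.1 i.1.2.2 U₀) (bondShift (sites_eq i.1.1 i.1.2.1 i.1.2.2 i.2.2.le) c))⁻¹ : (Matrix (Fin 2) (Fin 2) ℂ)ˣ) : Matrix (Fin 2) (Fin 2) ℂ)))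
          + (κY L i U₀ Y x A (bondShift (sites_eq i.1.1 i.1.2.1 i.1.2.2 i.2.2.le) c).src - ((emlIterU (i.1.2.2 - i.1.2.1) (bgUnits i.1.1 i.1.2.2 U₀) (bondShift (sites_eq i.1.1 i.1.2.1 i.1.2.2 i.2.2.le) c) : (Matrix (Fin 2) (Fin 2) ℂ)ˣ) : Matrix (Fin 2) (Fin 2) ℂ) * κY L i U₀ Y x A (bondShift (sites_eq i.1.1 i.1.2.1 i.1.2.2 i.2.2.le) c).tgt * (((emlIterU (i.1.2.2 - i.1.2.1) (bgUnits i.1.1 i.1.2.2 U₀) (bondShift (sites_eq i.1.1 i.1.2.1 i.1.2.2 i.2.2.le) c))⁻¹ : (Matrix (Fin 2) (Fin 2) ℂ)ˣ) : Matrix (Fin 2) (Fin 2) ℂ)))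
    (C : ℕ → ℝ)
    (hFR2 : ∀ (L : ℕ), 1 < L → ∀ (i : T3Thm1Carrier.Idx L) (U₀ : GaugeField (i.1.1.P i.1.2.2) 0 (Matrix.specialUnitaryGroup (Fin 2) ℂ)), RegPr i.1.1 i.1.2.1 i.1.2.2 (α L) U₀ →
      ∀ (Y : PBond (i.1.1.P i.1.2.2) 0 → Matrix (Fin 2) (Fin 2) ℂ) (s : ℝ) (x : Site (i.1.1.P i.1.2.2) 0) (A : Matrix (Fin 2) (Fin 2) ℂ), (∀ b, ‖Y b‖ ≤ s) →
        ∑ z : Site (i.1.1.P i.1.2.2) (i.1.2.2 - i.1.2.1), ‖κY L i U₀ Y x A z‖ ≤ C L * ((L : ℝ) ^ (i.1.2.2 - i.1.2.1))⁻¹ ^ 2 * s * ‖A‖) :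
    ∀ (L : ℕ), 1 < L → ∀ (i : T3Thm1Carrier.Idx L) (U₀ : GaugeField (i.1.1.P i.1.2.2) 0 (Matrix.specialUnitaryGroup (Fin 2) ℂ)), RegPr i.1.1 i.1.2.1 i.1.2.2 (α L) U₀ →
      ∀ (X' : PBond (i.1.1.P i.1.2.2) 0 → Matrix (Fin 2) (Fin 2) ℂ) (s : ℝ) (x : Site (i.1.1.P i.1.2.2) 0) (A : Matrix (Fin 2) (Fin 2) ℂ), (∀ b, ‖X' b‖ ≤ s) →
        ∑ y : PBond (i.1.1.P i.1.2.1) 0, ‖avgHess i.1.1 i.1.2.1 i.1.2.2 i.2.2.le U₀ X'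
            ((toL2 i.1.1 i.1.2.2 (c₀ L)).symm (DL2 i.1.1 i.1.2.1 i.1.2.2 (c₀ L) U₀ (toL2S i.1.1 i.1.2.2 (c₀ L) (Pi.single x A)))) y‖
          ≤ (240 + 6 * C L) * ((L : ℝ) ^ (i.1.2.2 - i.1.2.1))⁻¹ * s * ‖A‖ := by
  refine hqG_of_gaugeDir_column_family α (fun L => 240 + 6 * C L) c₀ fun L hL i U₀ hU X' s x A hX' => ?_
  have hLi : (i.1.1.L : ℝ) = (L : ℝ) := by exact_mod_cast i.2.1
  have hε : 10 ^ 10 * (i.1.1.L : ℝ) ^ 6 * α L ≤ 1 := by rw [hLi]; exact hα10 L hL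
  have hε12 : 10 ^ 12 * (i.1.1.L : ℝ) ^ 3 * α L ≤ 1 := by rw [hLi]; exact hα12 L hL
  have hcol := gaugeDir_column_of_pointwise_identity_and_FR2 (h := i.2.2.le) (hα0 L hL) hε hε12 U₀ hU (ns L i U₀) (h0 L i U₀) (hsucc L i U₀) (κY L i U₀)
    (h2 L hL i U₀ hU) (fun Y s x A hY => by rw [hLi]; exact hFR2 L hL i U₀ hU Y s x A hY) X' s x A hX'
  rw [hLi] at hcol
  exact hcol

end Family

end Summit.QuantumFields.YangMills.Theorems.Prop7AvgHessGaugeIdentityNormReading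

end
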